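import Mathlib
import Summits.QuantumAdvantage.QuantumAdvantage.Theses.MobiusLadder
import Summits.QuantumAdvantage.QuantumAdvantage.Theorems.MobiusLadderDigitPolyUniformityDefs
import Summits.QuantumAdvantage.QuantumAdvantage.Theorems.MobiusLadderDigitPolyUniformityLARShift
import Summits.QuantumAdvantage.QuantumAdvantage.Theorems.MobiusLadderDigitPolyUniformityLARComposition
import Literature.Computability.MetaComplexity.SmolenskyDimensionBound
import Literature.Computability.MetaComplexity.TruthTables
import Literature.NumberTheory.LFunctions.MatomakiRadziwillTaoTheorem13Proofs
import Literature.NumberTheory.LFunctions.KlurmanMangerelTeravainenShortAPs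
import Literature.NumberTheory.LFunctions.LiouvilleTwoPowerModuli
import Summits.QuantumAdvantage.QuantumAdvantage.Theorems.MobiusLadderDigitPolyUniformityRigidityWideFalse
import Summits.QuantumAdvantage.QuantumAdvantage.Theorems.MobiusLadderDigitPolyUniformityRigidityGlueFlex

/-!
# `DigitPolyUniformity` (stmt-QuantumAdvantage-1392) — line `Sketch` (c1: cards `smolensky-immunity`
# + `katai-carry-automaton`), composition via the Liouville Annihilator Rank (LAR)

Crux `Summit.QuantumAdvantage.QuantumAdvantage.Theses.MobiusLadder.DigitPolyUniformity` (route
`MobiusLadder`, rank 4): for every `A` and `ε > 0`, eventually in `n`, every `P ∈ 𝔽₂[x_0..x_{n−1}]`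
of total degree `≤ (log₂ n)^A` has `|Σ_{N<2^n} λ(N)(−1)^{P(bits N)}| ≤ ε 2^n`.

The line (card `smolensky-immunity`, ideator planner-cruxidea-stmt-QuantumAdvantage-1392-1-0): replace
cancellation by DIMENSION COUNTING. Identify `N < 2^n` with its digit vector `b ∈ {0,1}ⁿ` and let
`f = 1_{λ = −1}`, `p = 1_{P = 1}` as `𝔽₂`-valued functions on the cube. By the Smolensky–Carlet argument
(Carlet, CRYPTO 2006, proof of Thm. 1), a degree-`≤ k` polynomial `h` vanishing on the disagreement
set `E = {f ≠ p}` satisfies `h·f = h·p`, a polynomial of degree `≤ k + d` vanishing on `{f = 0}`, and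
`h ↦ h·f` has kernel inside the annihilators of `{f = 1}`; rank–nullity gives

  `dim lowDeg k ≤ |E| + annRank_k {λ = −1} + annRank_{k+d} {λ ≠ −1}`   (`stub_agreeCount`),

with `dim lowDeg k = Σ_{i ≤ k} C(n, i)` (`stub_finrank_lowDeg`). With `k = n/2 − s`,
`2^n ≤ 2 Σ_{i≤k} C(n,i) + 2s·C(n, n/2)` (`stub_two_pow_le`) and `C(n, n/2) ≤ 2^n/√n`
(`stub_choose_middle_le`), the correlation `Σ λ(−1)^P ≤ 2|agree| − 2^n + 1` (`stub_corr_le_card`)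
is `≤ 2s·2^n/√n + 2·(annihilator ranks) + 1`, and the same for `P + 1` bounds it from below. The only
non-elementary input is then the TRANSFERRED CRUX, in its final (v4) form — ONE set, ONE clause:

  `stub_LAR` (Liouville Annihilator Rank, below capacity): for every `ε > 0`, eventually in `n`, for
  all `k ≤ n/2 − ⌈ε√n⌉`, the degree-`≤ k` multilinear polynomials over `𝔽₂` vanishing on the
  Liouville digit set `liouSet n = {b : λ(val b) = −1}` span at most `ε 2ⁿ` dimensions

— an exact `𝔽₂`-rank statement about one explicit incidence matrix per `n`
(`[S ⊆ bits N]_{|S| ≤ k, λ(N) = −1}` has co-rank `≤ ε2ⁿ`). The second annihilator rank the count needs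
(that of the complement, at level `k + d`) is recovered from the same clause one bit up by the SHIFT
inequality `annRank_k((liouSet n)ᶜ) ≤ annRank_{k+1}(liouSet (n+1))` (`λ(2m) = −λ(m)`;
`lar_two_sets_of_one`, landed in `Theorems/…LARShift`), and the degree `d = (log₂ n)^A ≪ ε√n` is absorbed by the level slack.
The statement is STRONGER than the crux (it gives correlation `o(1)` up to degree `o(√n)`); conversely
the crux implies it at all levels `≤ (log₂ n)^A` and it holds unconditionally at level `≤ 1`
(`Theorems/…LARInverse`), and by Reed–Muller duality it is equivalent to the generic-profile statement for
the one set `liouSet n` at all levels away from capacity (`Theorems/…LARDuality`). Numerics (card j017179,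
this line's j018733): the profile equals the random one (`annRank_k = 0` for all `k < n/2`, forced value
`Σ_{i≤n/2}C(n,i) − |Y|` at `k = n/2`) for `n ≤ 16`.

Why this half of the sketch and not the Kátai half (`katai-carry-automaton`): line 0 of this crux
(lead prover-line-stmt-QuantumAdvantage-1392-0, `Lines/Sketch.lean`, `PromoteStub.md`) already built the
Kátai–BSZ reduction (landed `stub_bsz`, `stub_ends`, `stub_walshGapped`, `stub_singleDigit`) and found its
transfer stub crux-sized even at degree one, with two false versions on the way (bounded-depth ends;
all prime pairs); the window variant differs only by an energy increment and would meet the same wall.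
The LAR half is disjoint new infrastructure, its transferred statement is decidable by finite linear
algebra at each `n`, and its degree parameter is inert (the `2^{-d}` differencing barrier is not engaged).

Stubs: ALL LANDED except the transferred crux — `stub_finrank_lowDeg` (p114683), `stub_agreeCount`
(p115115), `stub_eval_mem_lowDeg` (p115662), `stub_two_pow_le` (p115995), `stub_choose_middle_le`
(p115895), `stub_corr_le_card` (p115986), the vocabulary (p116208), the shift stubs `stub_shiftMap_mem`
(p117608), `stub_val_succ` (p117720), `stub_shift_finrank` (p117699), all imported above;
`stub_LAR` (v4) is OPEN (the lead's; crux-sized). Composition `DigitPolyUniformity_of` is proved below.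

Status (seat c2, 2026-08-16): skeleton v5 = v4 made thin — the composition is landed for an ARBITRARY
degree function `d(n) = o(√n)` (`Theorems/…LARComposition`, p129794: `uniformity_of_lar`), which shows in
the kernel that `stub_LAR` is STRICTLY STRONGER than the crux (it gives uniformity up to degree
`(ε/16)√n`, `sqrt_degree_uniformity_of_lar`); containment `DigitPolyUniformity → QuadraticDigitPhases`
(stmt-1391; `Theorems/…ImpliesQuadratic`, p129840) and the cross-summit twin
`DigitPolyUniformity ↔ PneNP.Mobius.LiouvilleDigitalPhases` (stmt-PneNP-1107; `Theorems/…Twin`) landed.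

Status (seat c3, 2026-08-17): skeleton unchanged (`stub_LAR` the only open stub, crux-sized, held by the
lead). Cycle 3 landed, as `--supports` stubs of this line, the AUTOMATIC-PHASE CLASS of the crux modulo
the named fact `Literature.NumberTheory.LFunctions.mullner_moebius_automatic` (Müllner 2017, Thm. 1.2;
residual content `mullner2017_thm44`): `Theorems/…LiouvilleAutomatic` (λ-Müllner from the μ fact),
`…AutomaticDyadic`, `…AutomaticBase`, `…BlockAdditiveAutomatic`, `…DigitWeightAutomatic`,
`…BaseAdditiveAutomatic`, `…AutomaticOfPow` (Cobham easy half), `…EsymmIndicator`,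
`…ChooseModTwoPeriodic`, and the crux-form classes `…AutomaticClasses` (every real 2-automatic
weight; block-additive / Rudin–Shapiro; digit-sum class / `e_k`) and `…BlockDiagonal` (aligned
block-diagonal phases / the inner-product bent function `x_0x_1 + x_2x_3 + ⋯`). These are the first
bent-type phases of rank `≍ n` settled (conditionally) in the tree; dossier
`Cruxes/DigitPolyUniformity/Lines/SketchLAR-c3-automatic.md`.

Status (seat c4, 2026-08-17): skeleton unchanged (`stub_LAR` the only open stub, crux-sized, held by the
lead). Cycle 4 landed, as `--supports` stubs of this line, the CALIBRATION OF THE CONSUMER: the weak glue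
(`Theorems/…WeakGlue`: the R1 rung needs only one-sided constant-error inapproximability on the top block —
strictly weaker than the crux and not behind stmt-1391; `…WeakOfCrux`: crux ⇒ weak form), the short-interval
Walsh ⇔ low-affine/mirror equivalence (`…LowAffine`, `…ShortWalshIff`, `…Mirror`), and the unconditional
functional-equation calibration (`…DegreeDistance`: Reed–Muller-distance bound for every degree, exact
𝔽₂-degree of `λ_n ≥ n − 1`; `…MulThreeFlip`: ×3 near-solutions; `…ShiftInvariant`, `…SymmetricShift`,
`…SymmetricCorr`: `|corr| ≤ 1/3` for all shift-invariant / symmetric phases of any degree); dossier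
`Cruxes/DigitPolyUniformity/Lines/SketchLAR-c4-weak.md`.
-/

noncomputable section

namespace Summit.QuantumAdvantage.DigitPolyUniformity.SketchLAR

open Filter Finset Module
open Literature.Computability.MetaComplexity (boolFunEquivFin)
open Literature.Computability.MetaComplexity.Smolensky (CubeFn mono lowDeg)
open Summit.QuantumAdvantage.QuantumAdvantage.Theses.MobiusLadder (DigitPolyUniformity)

/-! ### Vocabulary of the transferred crux

`vanishOn F Y` (functions on the cube vanishing on `Y`), `annRank F n k Y = finrank (lowDeg F n k ⊓ vanishOn F Y)`
(the annihilator rank) and `liouSet n = {b | λ(val b) = −1}` (the Liouville digit set, `val` through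
`boolFunEquivFin`) are LANDED in `Theorems/MobiusLadderDigitPolyUniformityDefs.lean` (p116208, with the API
`annRank_mono_left`, `annRank_anti`, `forced_le_annRank`, …) and imported above. -/

/-! ### The stubs

Six of the seven registered stubs are LANDED (wave 1, 2026-08-16) and imported above under the same
names (namespace `Summit.QuantumAdvantage.DigitPolyUniformity.SketchLAR`):
* `stub_finrank_lowDeg` — `finrank ↥(lowDeg F n k) = Σ_{i ≤ k} C(n,i)`:
  `Theorems/MobiusLadderDigitPolyUniformityLARFinrankLowDeg.lean` (p114683);
* `stub_agreeCount` — the Smolensky–Carlet count in rank–nullity form: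
  `Theorems/MobiusLadderDigitPolyUniformityLARAgreeCount.lean` (p115115);
* `stub_eval_mem_lowDeg` — `MvPolynomial` evaluation on the cube lies in `lowDeg (totalDegree)`:
  `Theorems/MobiusLadderDigitPolyUniformityLAREvalMemLowDeg.lean` (p115662);
* `stub_two_pow_le` — `2^n ≤ 2 Σ_{i ≤ n/2−s} C(n,i) + 2 s C(n,n/2)`:
  `Theorems/MobiusLadderDigitPolyUniformityLARTwoPowLe.lean` (p115995);
* `stub_choose_middle_le` — `C(n, n/2) ≤ 2^n/√n`:
  `Theorems/MobiusLadderDigitPolyUniformityLARChooseMiddleLe.lean` (p115895);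
* `stub_corr_le_card` — `Σ_{N<2^n} λ(N)(−1)^{[P=1]} ≤ 2|{f = p}| − 2^n + 1`:
  `Theorems/MobiusLadderDigitPolyUniformityLARCorrLeCard.lean` (p115986).
The only remaining `sorry` is the transferred crux `stub_LAR`. -/

/-- **Stub (the transferred crux `C⁺`: LIOUVILLE ANNIHILATOR RANK, below capacity, ONE SET, ONE CLAUSE —
OPEN, the lead's stub; v4).** For every `ε > 0`, eventually in `n`: at every level `k ≤ n/2 − ⌈ε√n⌉` the
degree-`≤ k` multilinear polynomials over `𝔽₂` vanishing on the Liouville digit set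
`liouSet n = {b ∈ {0,1}ⁿ : λ(val b) = −1}` span at most `ε·2ⁿ` dimensions — i.e. there is no
`ε2ⁿ`-dimensional family of dense one-sided degree-`≤ k` algebraic certificates for `λ = +1`.
History of the reshapes (all weakenings or equivalences, each with a landed/proved reduction):
v1 = the card's `C⁺` (level cap `n/2 + (log₂n)^A − ⌈ε√n⌉`, two sets); v2 drops `A` (cap `n/2 − ⌈ε√n⌉`:
the composition absorbs the degree `(log₂n)^A ≪ ε√n`); v3 = one-set generic-profile form, EQUIVALENT to
v2 by Reed–Muller duality (`lar_iff_profile`, `Theorems/…LARDuality`); v4 (this) drops the complement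
clause of v2: it is RECOVERED by the shift inequality `annRank_k((liouSet n)ᶜ) ≤ annRank_{k+1}(liouSet (n+1))`
(`annRank_compl_le_shift`, landed in `Theorems/…LARShift`, where multiplicativity `λ(2m) = −λ(m)` enters) — `lar_two_sets_of_one`.
(Random sets of density `½` have annihilator rank `0` at all `k ≤ n/2 − 1` whp — Reed–Muller codes achieve
capacity on the BEC, and `k = n/2 − ε√n` is rate `½ − Θ(ε)`; numerically the Liouville set has the same
profile for `n ≤ 16`, card j017179.) Still stronger than the crux: it yields correlation `o(1)` against
all degrees `o(√n)`; conversely the crux implies it at all levels `≤ (log₂n)^A`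
(`lar_of_digitPolyUniformity`, `Theorems/…LARInverse`), and it holds unconditionally at level `≤ 1`. -/
theorem stub_LAR :
    ∀ ε : ℝ, 0 < ε → ∀ᶠ n : ℕ in atTop, ∀ k : ℕ, k + ⌈ε * Real.sqrt n⌉₊ ≤ n / 2 →
      (annRank (ZMod 2) n k (liouSet n) : ℝ) ≤ ε * 2 ^ n := by
  sorry

/-! ### From one clause to two, and the composition (all LANDED)

The shift inequality `annRank_k((liouSet n)ᶜ) ≤ annRank_{k+1}(liouSet (n+1))` and `lar_two_sets_of_one`
(one set, one clause ⇒ both sets) are landed in `Theorems/MobiusLadderDigitPolyUniformityLARShift.lean`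
(p126584); the Smolensky–Carlet composition for an ARBITRARY degree function `d(n) = o(√n)` with LAR as a
hypothesis — `corr_le_of_ranks`, `abs_corr_le_of_ranks`, `uniformity_of_lar`,
`sqrt_degree_uniformity_of_lar`, `polylog_degree_uniformity_of_lar` — is landed in
`Theorems/MobiusLadderDigitPolyUniformityLARComposition.lean` (p129794, seat c2). Both are imported above,
so the skeleton is now: ONE open stub + a one-line composition. -/

/-- **Composition (registered form): the crux from the stub.** `DigitPolyUniformity` is the instance
`d(n) = (log₂ n)^A` of `uniformity_of_lar` (LAR ⇒ uniformity against every degree `o(√n)`), fed with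
`stub_LAR`; polylogarithms are admissible (`natLog_pow_admissible`). -/
theorem DigitPolyUniformity_of : DigitPolyUniformity := by
  unfold DigitPolyUniformity
  intro A
  exact polylog_degree_uniformity_of_lar stub_LAR A

/-! ### Cycle 4 (seat c4): calibration stubs — what the R1 rung actually needs, and the low-affine class

Wave 1 (2026-08-17) LANDED in the tree under the same names (namespace
`Summit.QuantumAdvantage.DigitPolyUniformity.SketchLAR`; `--supports` stubs, they do not enter
`DigitPolyUniformity_of` and are not imported here, to keep this workfile independent of them):
* `liouvilleNotAC0Xor_of_inapprox` — WEAK GLUE: the `AC⁰[⊕]` rung `L_λ ∉ AC0Mod 2` already follows from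
  ONE-SIDED CONSTANT-ERROR inapproximability on the top dyadic block (`∃ c > 0, ∀ A, ∀ᶠ n, ∀ P` of degree
  `≤ (log₂ n)^A`: `Σ_{2^{n−1} ≤ N < 2ⁿ} λ χ_P ≤ (1/2 − c) 2ⁿ`), by Razborov–Smolensky with error `2^{−t}`:
  `Theorems/MobiusLadderDigitPolyUniformityWeakGlue.lean` (p133291);
* `inapprox_of_digitPolyUniformity` — the crux implies that weak form for every `c < 1/2`:
  `Theorems/MobiusLadderDigitPolyUniformityWeakOfCrux.lean` (p133218);
* `digitPolyUniformity_lowAffine_of_shortWalsh` — the LOW-AFFINE class (all `P` affine in the low `h(n)`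
  digits with coefficients arbitrary functions of the high digits: mirror forms, Maiorana–McFarland phases)
  from averaged short-interval Walsh uniformity of `λ` at scale `2^{h(n)}`:
  `Theorems/MobiusLadderDigitPolyUniformityLowAffine.lean` (p133305).

Wave 2 (2026-08-17) LANDED in the tree under the same names (same namespace; `--supports`):
* `shortWalsh_iff_lowAffine` — short-interval Walsh uniformity at scale `2^{h(n)}` is EQUIVALENT to the
  uniformity of the whole low-affine class at that cut: `Theorems/…ShortWalshIff.lean` (p134046);
* `digitPolyUniformity_mirror_of_shortWalsh` — the mirror forms `Σ_{i<m} x_i x_{n−1−i}` (stmt-1391's named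
  hard case) from the balanced-cut hypothesis: `Theorems/…Mirror.lean` (p134303);
* `liouville_corr_le_of_totalDegree` — UNCONDITIONAL Reed–Muller-distance inapproximability for every
  degree `d`: `Σ_{N<2ⁿ} λ χ_P ≤ 2ⁿ − 2^{n−1−d}` (so the exact 𝔽₂-degree of `[λ = −1]` on `[0,2ⁿ)` is
  `≥ n − 1`, sharp i.o. numerically), with the general tool `DegreeDistance.rm_distance`:
  `Theorems/…DegreeDistance.lean` (p134408);
* `exists_lowDegree_mulThree_flip` — single-prime functional equations of `λ` have degree-`(d+1)`
  digital solutions off a `2^{−d}` fraction (the `×3` case; `χ₋₄` of the odd part):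
  `Theorems/…MulThreeFlip.lean` (p133987).

Wave 3 (2026-08-17) LANDED in the tree under the same names (same namespace; `--supports`):
* `liouville_corr_le_of_shiftInvariant` — UNCONDITIONAL: every shift-invariant digital phase
  (`P(bits 2N) = P(bits N)` for `2N < 2ⁿ`) has `3·|Σ_{N<2ⁿ} λ χ_P| ≤ 2ⁿ + 1` (what the prime `2` gives at
  constant level, uniformly over growing families; abstract `ShiftInvariant.three_mul_abs_sum_le`):
  `Theorems/…ShiftInvariant.lean` (p134783);
* `eval_digits_double_of_isSymmetric` — symmetric polynomials are shift-invariant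
  (`bits 2N = bits N ∘ finRotate n`): `Theorems/…SymmetricShift.lean` (p134777);
* corollary (lead) `liouville_corr_le_of_isSymmetric` — every SYMMETRIC `P` of any degree has correlation
  `≤ 1/3 + 2^{−n}/3` with `λ`, unconditionally: `Theorems/…SymmetricCorr.lean`.

Dossier of the cycle: `Cruxes/DigitPolyUniformity/Lines/SketchLAR-c4-weak.md` (the weak target W for R1,
the functional-equation calibration — 2-adic shell functions and Benford chirps — and SIW ⇔ low-affine). -/

/-! Wave 4 (2026-08-17) LANDED in the tree under the same names (same namespace; `--supports`):
* `liouvilleNotAC0Xor_of_inapprox_range` — the weak glue in FULL-RANGE form: `(∃ c > 0, ∀ A, ∀ᶠ n, ∀ P` of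
  degree `≤ (log₂ n)^A`: `Σ_{N<2ⁿ} λ χ_P ≤ (1 − c) 2ⁿ) → L_λ ∉ AC0Mod 2` (Razborov–Smolensky at the `t+1`
  top lengths glued along the leading digit): `Theorems/…WeakGlueRange.lean` (p135858) — so the weak
  target W for R1 may be stated as "no polylog-degree 𝔽₂-polynomial agrees with `[λ = −1]` on 99% of
  `[0, 2ⁿ)`";
* `liouville_corr_le_of_slidingWindow` — sliding-window (zero-padded stationary) forms of ANY window,
  incl. Rudin–Shapiro, are shift-invariant ⇒ `|corr| ≤ 1/3` unconditionally: `Theorems/…SlidingWindow.lean`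
  (p135427);
* `liouville_weight_corr_le_of_doubling` (+ `liouville_digitSumWeight_corr_le`) — doubling-invariant
  weights, digit-sum weights of ANY modulus: `|corr| ≤ 1/3` unconditionally: `Theorems/…DoublingWeight.lean`
  (p135208, lead).

After wave 4 the only open stub is again `stub_LAR` (crux-sized). -/

/-! ### Cycle 5 (seat c5): the MATOMÄKI–RADZIWIŁŁ–TAO CLASSES — registered stubs

The tree PROVES (standard axioms) Matomäki–Radziwiłł–Tao 2015, Theorem 1.3,
`Literature.NumberTheory.LFunctions.Tao2016.MatomakiRadziwillTao2015_theorem13_holds`: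
`∃ C, ∀ H X : ℝ, 10 ≤ H → H ≤ X → ∀ α, ∫ x in 0..X, ‖Σ_{n ∈ Icc ⌈x⌉₊ ⌊x+H⌋₊} λ(n) e(αn)‖ ≤ C (log log H / log H + log^{−1/700} X) H X`
(`e = Literature.NumberTheory.LFunctions.VdC.e`, `e x = exp(2πix)`). Transferred to the ALIGNED dyadic blocks
`[2^h y, 2^h (y+1))` it yields, unconditionally and uniformly in `α`, short-block cancellation of `λ·e(α·)` at every
depth `h ≥ h₀(ε)` (`stub_alignedMRT`), whence (compositions, lead, file `Theorems/…MRTClasses`): for every `ε`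
there is a FIXED depth `h₀` such that eventually every `P ∈ 𝔽₂[x_{h₀}, …, x_{n−1}]` (any degree — every phase that
ignores the `h₀` lowest digits) and, for each fixed `C`, every `P` in the variables `{x_i : i < C ∨ i ≥ h₀}` (every
1-bounded weight `g(N mod 2^C, ⌊N/2^{h₀}⌋)`) has `|Σ_{N<2ⁿ} λ χ_P| ≤ ε 2ⁿ`. The stubs below are the independent leaves:
`stub_integral_window_eq_sum` (the MRT integral is a sum over integer left end-points), `stub_window_average`
(aligned blocks against all windows, by 2-Lipschitz sliding), `stub_fourier_lowDigits` (finite Fourier expansion on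
`ℤ/2^C` with 1-bounded coefficients), `stub_regroup_blocks` (regrouping `Σ_{N<2^{h+m}}` over aligned blocks),
`stub_eval_eq_of_vars_ends` (`vars`-locality of the digit evaluation); `stub_alignedMRT` (lead) composes the first
two with the named theorem. They are `--supports` material and do not enter `DigitPolyUniformity_of`.

Status (2026-08-17, seat c5, end of the cycle-5 wave): ALL SIX LANDED in the tree under the same names (namespace
`Summit.QuantumAdvantage.DigitPolyUniformity.SketchLAR`): `stub_eval_eq_of_vars_ends` —
`Theorems/MobiusLadderDigitPolyUniformityMRTEvalEnds.lean` (p137123); `stub_fourier_lowDigits` —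
`Theorems/…MRTFourierLowDigits.lean` (p137136); `stub_regroup_blocks` — `Theorems/…MRTRegroupBlocks.lean` (p137144);
`stub_integral_window_eq_sum` — `Theorems/…MRTWindowIntegral.lean` (p137200); `stub_window_average` —
`Theorems/…MRTWindowAverage.lean` (p137231); `stub_alignedMRT` — `Theorems/…MRTAligned.lean` (p137786); the
compositions (the classes in crux form: `digitPolyUniformity_topDigits`, `digitPolyUniformity_twoEnds`, their
growing-depth forms, and the weight forms `liouville_twoEnds_weight_le(_real)`, `liouville_topDigits_weight_le_real`,
`liouville_aligned_blocks_le`) — `Theorems/…MRTClasses.lean`. The sorried copies below are kept only so that this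
workfile stays independent of the new modules; dossier `Cruxes/DigitPolyUniformity/Lines/SketchLAR-c5-mrt.md`. -/

/-! Cycle-5 / cycle-6-stub registry copies REMOVED from this skeleton (2026-08-17, seat c6, cycle 7): `stub_integral_window_eq_sum`,
`stub_window_average`, `stub_fourier_lowDigits`, `stub_regroup_blocks`, `stub_eval_eq_of_vars_ends`, `stub_alignedMRT`,
`liouville_twoEnds_weight_le`, `digitPolyUniformity_twoEnds`, `digitPolyUniformity_topDigits`, `inapprox_range_of_rigidity`,
`stub_alignedMRT_wide`, `liouville_twoEnds_weight_le_wide`, `inapprox_range_of_rigidity_wide` are ALL LANDED under the same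
names (`Theorems/…MRTWindowIntegral`, `…MRTWindowAverage`, `…MRTFourierLowDigits`, `…MRTRegroupBlocks`, `…MRTEvalEnds`,
`…MRTAligned`, `…MRTClasses`, `…RigidityGlue`, `…MRTAlignedWide`, `…RigidityGlueWide`) and are now IMPORTED (transitively,
through `…RigidityWideFalse` / `…RigidityGlueFlex`), so the sorried copies had to go (name clash; and the gate caps a
skeleton at 40 registered stubs). -/

/-! ### Cycle 6 (seat c6): ¬RigidityWide — bottom-end (2-adic) chirps — ALL LANDED (imported above)

`Theorems/MobiusLadderDigitPolyUniformityChirp{Ind,NoSmallRelation,Kronecker,BalanceDefect,LiftBasic,LiftClassSum,LiftOddDefect,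
Interp,DefectPeriodic,CorrLe}.lean` (stubs A–G: p141580 p141404 p142721 p141612 p141361 p142241 p142242 p142129 p141426 p142243),
`Theorems/MobiusLadderDigitPolyUniformityRigidityWideFalse.lean` (`Chirp.exists_chirp`, `Chirp.rigidityWide_false`, p144107) and
`Theorems/MobiusLadderDigitPolyUniformityRigidityGlueFlex.lean` (`rigidityFlex_of_rigidity`, `rigidityFlex_of_rigidityWide`,
`inapprox_range_of_rigidity_flex`, `liouvilleNotAC0Xor_of_rigidity_flex`, p143185).  Their registry copies were removed from this
skeleton once landed (the gate caps a skeleton at 40 stubs); dossier `Lines/SketchLAR-c6-chirps.md`. -/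

/-- Cycle 6 record: RigidityWide is false (re-export of the landed theorem, so that this skeleton still shows the cycle-6
conclusion by name). [folklore] -/
theorem rigidityWide_false_landed :
    ¬ (∃ C C' : ℕ, ∃ η ρ : ℝ, 0 < η ∧ 0 < ρ ∧ ∀ A h₀ : ℕ, ∀ᶠ n : ℕ in atTop,
      ∀ P : MvPolynomial (Fin n) (ZMod 2), P.totalDegree ≤ Nat.log 2 n ^ A →
        (∀ p : ℕ, p.Prime → p ≤ C →
          ((((Ico 1 (2 ^ n / p)).filter fun m =>
              (if MvPolynomial.eval (fun i : Fin n => if Nat.testBit (p * m) i then (1 : ZMod 2) else 0) P = 1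
                then (-1 : ℝ) else 1) =
              (if MvPolynomial.eval (fun i : Fin n => if Nat.testBit m i then (1 : ZMod 2) else 0) P = 1
                then (-1 : ℝ) else 1)).card : ℕ) : ℝ) ≤ η * 2 ^ n) →
        ∃ h : ℕ, h₀ ≤ h ∧ h + h₀ ≤ n ∧ ∃ g : ℕ → ℕ → ℝ, (∀ a b, |g a b| ≤ 1) ∧
          ρ * 2 ^ n ≤ |∑ N ∈ range (2 ^ n),
            (if MvPolynomial.eval (fun i : Fin n => if Nat.testBit N i then (1 : ZMod 2) else 0) P = 1
              then (-1 : ℝ) else 1) * g (N % 2 ^ C') (N / 2 ^ h)|) :=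
  Chirp.rigidityWide_false

/-! ### Cycle 7 (seat c6): the KLURMAN–MANGEREL–TERÄVÄINEN CLASS — registered stubs + lead theorems

Cycle 6 showed that a rigidity statement for the `AC⁰[⊕]` rung must offer tests of SUPER-POLYLOGARITHMIC bottom depth
(2-adic chirps) at EVERY top depth (Benford chirps); products of the two near-solution families are caught only by
tests `g(N mod 2^k, ⌊N/2^h⌋)` with BOTH `k` large and `h` free.  The λ-side of such tests is exactly "λ in short
intervals AND arithmetic progressions to moduli `2^k` simultaneously" — Klurman–Mangerel–Teräväinen 2023, Theorem 1.6 /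
Corollary 1.7 (the tree's named fact `Literature.NumberTheory.LFunctions.KMT2023_corollary17_liouville_twoPower`,
special case `f = λ`, `q = 2^k`, unconditional regime `Q ≤ X^{ε^{200}}`).  From it (CONDITIONALLY on that named fact),
with the main term killed by the tree's PROVED `green_liouville_character_twoPower_holds` (no exceptional zero for
2-power conductors) and the even residues reduced to odd ones at smaller moduli (`λ(2m) = −λ(m)`), plus the tree's
PROVED Matomäki–Radziwiłł–Tao aligned blocks for the class of `0`:

* `liouville_windowFree_weight_le` — for every `ε > 0` there are `c > 0`, `w₀` with, eventually in `n`, for all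
  `k ≤ c√n` and `h` with `k + w₀ ≤ h ≤ n − w₀` and every 1-bounded `g`: `|Σ_{N<2ⁿ} λ(N) g(N mod 2^k, ⌊N/2^h⌋)| ≤ ε2ⁿ`
  (the WINDOW-FREE TWO-ENDS CLASS: all digits except a window `[k, h)` of width `≥ w₀` starting below depth `c√n`);
* `digitPolyUniformity_windowFree` — the crux for every `P` whose variables avoid such a window (contains and
  sharpens line 0's `stub_ends`, `(k+m)^3 ≤ n`, and seat c5's two-ends classes, `k = C` fixed);
* `inapprox_range_of_rigidity_natural`, `liouvilleNotAC0Xor_of_rigidity_natural` — W and `L_λ ∉ AC0Mod 2` from the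
  NATURAL rigidity hypothesis Rigidity♮ (tests = window-free two-ends functions), which every known near-solution
  family (shell characters, Benford chirps of any frequency, 2-adic chirps, and their products) passes as a test.

Stubs `stub_kmt_*` are worked by one stub-worker each; `liouville_oddAP_blocks_le` (the per-scale Cauchy–Schwarz /
window-averaging / dyadic assembly from KMT) and the compositions are the lead's.
-/

namespace KMT

open Literature.NumberTheory.LFunctions

/-! ### Stubs (cycle 7) -/

/-- **Stub KMT-R (regrouping a two-ends correlation into block/residue sums).** For `h ≤ n`, any `lam` and 1-bounded
`g`: `|Σ_{N<2ⁿ} lam(N) g(N mod 2^k, ⌊N/2^h⌋)| ≤ Σ_{y<2^{n−h}} Σ_{a<2^k} |Σ_{N ∈ [2^h y, 2^h y + 2^h), N ≡ a (2^k)} lam(N)|`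
(`⌊N/2^h⌋ = y` on the block `y`). [folklore] -/
theorem stub_kmt_regroup (lam : ℕ → ℝ) (g : ℕ → ℕ → ℝ) (hg : ∀ a b, |g a b| ≤ 1) (n k h : ℕ) (hhn : h ≤ n) :
    |∑ N ∈ range (2 ^ n), lam N * g (N % 2 ^ k) (N / 2 ^ h)| ≤
      ∑ y ∈ range (2 ^ (n - h)), ∑ a ∈ range (2 ^ k),
        |∑ N ∈ (Ico (2 ^ h * y) (2 ^ h * y + 2 ^ h)).filter (fun N => N % 2 ^ k = a), lam N| := by
  sorry

/-- **Stub KMT-V (2-adic valuation split of the residues).** For `k ≤ h` the block/residue sums of `λ` modulo `2^k`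
split according to `v₂(a)`: the classes `a = 2^j a'` (`a'` odd, `j < k`) are `2^j ×` the odd classes modulo
`2^{k−j}` in blocks of length `2^{h−j}` (`λ(2^j m) = (−1)^j λ(m)`), and the class `a = 0` is `2^k ×` plain blocks of
length `2^{h−k}`. [folklore] -/
theorem stub_kmt_valuation_split (n k h : ℕ) (hkh : k ≤ h) :
    ∑ y ∈ range (2 ^ (n - h)), ∑ a ∈ range (2 ^ k),
        |∑ N ∈ (Ico (2 ^ h * y) (2 ^ h * y + 2 ^ h)).filter (fun N => N % 2 ^ k = a),
          ((ArithmeticFunction.liouville N : ℤ) : ℝ)| ≤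
      (∑ j ∈ range k, ∑ y ∈ range (2 ^ ((n - j) - (h - j))), ∑ a ∈ (range (2 ^ (k - j))).filter (fun a => Odd a),
        |∑ N ∈ (Ico (2 ^ (h - j) * y) (2 ^ (h - j) * y + 2 ^ (h - j))).filter (fun N => N % 2 ^ (k - j) = a),
          ((ArithmeticFunction.liouville N : ℤ) : ℝ)|) +
      ∑ y ∈ range (2 ^ ((n - k) - (h - k))),
        |∑ N ∈ Ico (2 ^ (h - k) * y) (2 ^ (h - k) * y + 2 ^ (h - k)), ((ArithmeticFunction.liouville N : ℤ) : ℝ)| := by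
  sorry

/-- **Stub KMT-D (discretisation of an integral of a step function).** For naturals `X ≤ Y` and `F : ℕ → ℝ`,
`∫_X^Y F(⌊x⌋) dx = Σ_{m ∈ [X, Y)} F(m)`. [folklore] -/
theorem stub_kmt_discretise (F : ℕ → ℝ) (X Y : ℕ) (hXY : X ≤ Y) :
    ∫ x in (X : ℝ)..(Y : ℝ), F ⌊x⌋₊ = ∑ m ∈ Ico X Y, F m := by
  sorry

/-- **Stub KMT-W (aligned block versus the windows to its right, inside one residue class).** For 1-bounded `c`,
`0 < T ≤ H`, any `q, a, B`: the sum of `c` over `n ∈ [B, B+H)`, `n ≡ a (q)` differs from the sum over the window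
`(m, m+H]`, `m ∈ [B, B+T)`, by at most `2(T/q + 1)` (two intervals of length `≤ T` contain at most `T/q + 1` members
of the class each; for `q = 0`, `n % 0 = n` and the class is a single point), hence averaging over the `T` windows:
`|S| ≤ T⁻¹ Σ_{m ∈ [B,B+T)} |W_m| + 2(T/q + 1)`. [folklore] -/
theorem stub_kmt_window_average_AP (c : ℕ → ℝ) (hc : ∀ n, |c n| ≤ 1) (q a B H T : ℕ) (hT : 0 < T)
    (hTH : T ≤ H) :
    |∑ n ∈ (Ico B (B + H)).filter (fun n => n % q = a), c n| ≤
      (1 / (T : ℝ)) * ∑ m ∈ Ico B (B + T), |∑ n ∈ (Ioc m (m + H)).filter (fun n => n % q = a), c n| +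
        2 * ((T : ℝ) / q + 1) := by
  sorry

/-- **Stub KMT-M (the main term is negligible: λ twisted by a real character to a 2-power modulus).** From the
tree's PROVED `green_liouville_character_twoPower_holds` (Green 2012 Thm 3 / Montgomery–Vaughan §11.3.1 for
`q = 2^t`, no exceptional zero): constants `c₂ > 0`, `K` with, for all `k`, `X ≥ 1` with `2^k ≤ e^{c₂√log X}` and
every REAL Dirichlet character `χ (mod 2^k)`: `|χ(a)| ≤ 1` and `|Σ_{X≤n≤2X} λ(n)χ(n)| ≤ K X e^{−c₂√log X}`.
[cite: Green2012, Theorem 3 and §1 (remark on the Liouville function)] -/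
theorem stub_kmt_mainTerm :
    ∃ c₂ : ℝ, 0 < c₂ ∧ ∃ K : ℝ, ∀ k X : ℕ, 1 ≤ X →
      (2 : ℝ) ^ k ≤ Real.exp (c₂ * Real.sqrt (Real.log X)) →
      ∀ χ : DirichletCharacter ℝ (2 ^ k),
        (∀ a : ZMod (2 ^ k), |χ a| ≤ 1) ∧
        |∑ n ∈ Icc X (2 * X), (ArithmeticFunction.liouville n : ℝ) * χ (n : ZMod (2 ^ k))| ≤
          K * X * Real.exp (-(c₂ * Real.sqrt (Real.log X))) := by
  sorry

/-- **Stub KMT-C (Cauchy–Schwarz from a mean square with main term to an `L¹` bound).**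
`Σ_{m∈s} Σ_{a∈t} |W| ≤ √(#s·#t) · √(2 ΣΣ (W − M)² + 2 ΣΣ M²)`. [folklore] -/
theorem stub_kmt_cauchySchwarz (s t : Finset ℕ) (W M : ℕ → ℕ → ℝ) :
    ∑ m ∈ s, ∑ a ∈ t, |W m a| ≤
      Real.sqrt ((s.card : ℝ) * t.card) *
        Real.sqrt (2 * ∑ m ∈ s, ∑ a ∈ t, (W m a - M m a) ^ 2 + 2 * ∑ m ∈ s, ∑ a ∈ t, (M m a) ^ 2) := by
  sorry

/-- **Stub KMT-Y (dyadic decomposition of the block index range).**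
`Σ_{y<2^{n−h}} F(y) = F(0) + Σ_{h ≤ i < n} Σ_{2^{i−h} ≤ y < 2^{i+1−h}} F(y)` (for `h ≥ n` both sides are `F 0`).
[folklore] -/
theorem stub_kmt_dyadic (F : ℕ → ℝ) (h n : ℕ) :
    ∑ y ∈ range (2 ^ (n - h)), F y = F 0 + ∑ i ∈ Ico h n, ∑ y ∈ Ico (2 ^ (i - h)) (2 ^ (i + 1 - h)), F y := by
  sorry

/-- **Stub KMT-A (members of a residue class in an interval).** `#{n ∈ [u, v) : n % q = a} ≤ (v − u)/q + 1`
(truncated subtraction; for `q = 0` the class is a single point). [folklore] -/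
theorem stub_kmt_count_AP (u v q a : ℕ) :
    ((((Ico u v).filter (fun n => n % q = a)).card : ℕ) : ℝ) ≤ ((v - u : ℕ) : ℝ) / q + 1 := by
  sorry

/-- **Stub KMT-B (aligned plain blocks, real form, every depth).** From the tree's PROVED `stub_alignedMRT_wide`
(Matomäki–Radziwiłł–Tao) at `α = 0`: for every `ε > 0` there is `h₀` with, eventually in `n`, for all
`h₀ ≤ h ≤ n − h₀`: `Σ_{y<2^{n−h}} |Σ_{N ∈ [2^h y, 2^h y + 2^h)} λ(N)| ≤ ε2ⁿ`. [cite: MatomakiRadziwillTao2015, Theorem 1.3] -/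
theorem stub_kmt_alignedBlocks_real :
    ∀ ε : ℝ, 0 < ε → ∃ h₀ : ℕ, ∀ᶠ n : ℕ in atTop, ∀ h : ℕ, h₀ ≤ h → h + h₀ ≤ n →
      ∑ y ∈ range (2 ^ (n - h)),
        |∑ N ∈ Ico (2 ^ h * y) (2 ^ h * y + 2 ^ h), ((ArithmeticFunction.liouville N : ℤ) : ℝ)| ≤ ε * 2 ^ n := by
  sorry

/-! ### Lead: odd residues from Klurman–Mangerel–Teräväinen -/

/-- **Odd residue classes at one dyadic scale (lead; CONDITIONAL on the KMT named fact).** Constants `A, c₂, K'`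
such that for admissible parameters (`0 < ε₁ ≤ 1`, `1 ≤ k`, `k + 4 ≤ h`, `τ ≤ h ≤ i`, window `(h−k) log 2 ≥ ε₁^{−200}`,
typicality `(h−k)ε₁² log 2 ≥ log 541`, `k ≤ ε₁^{200} i`, main term `k² log 2 ≤ c₂² i`) the odd-residue block sums of
`λ` modulo `2^k` over the blocks of length `2^h` inside `[2^i, 2^{i+1})` total at most
`2^i (2^τ (A√ε₁ + K' e^{−c₂√(i log 2)}) + 2/2^τ + 2·2^k/2^h)`: windows to the right of each block
(`stub_kmt_window_average_AP`, `T = 2^{h−τ}`), Cauchy–Schwarz (`stub_kmt_cauchySchwarz`), the mean square from the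
KMT named fact (`stub_kmt_discretise`), the main term from `stub_kmt_mainTerm`.
[cite: KlurmanMangerelTeravainen2023ShortAPs, Corollary 1.7 and Theorem 1.6] -/
theorem kmt_oddAP_scale_le (hKMT : KMT2023_corollary17_liouville_twoPower) :
    ∃ A : ℝ, 0 ≤ A ∧ ∃ c₂ : ℝ, 0 < c₂ ∧ ∃ K' : ℝ, 0 ≤ K' ∧
      ∀ (ε₁ : ℝ) (τ i k h : ℕ), 0 < ε₁ → ε₁ ≤ 1 → 1 ≤ k → k + 4 ≤ h → τ ≤ h → h ≤ i →
        ε₁ ^ (-(200 : ℝ)) ≤ ((h - k : ℕ) : ℝ) * Real.log 2 →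
        Real.log 541 ≤ ((h - k : ℕ) : ℝ) * ε₁ ^ 2 * Real.log 2 →
        (k : ℝ) ≤ ε₁ ^ (200 : ℕ) * i →
        (k : ℝ) ^ 2 * Real.log 2 ≤ c₂ ^ 2 * i →
        ∑ y ∈ Ico (2 ^ (i - h)) (2 ^ (i + 1 - h)), ∑ a ∈ (range (2 ^ k)).filter (fun a => Odd a),
          |∑ N ∈ (Ico (2 ^ h * y) (2 ^ h * y + 2 ^ h)).filter (fun N => N % 2 ^ k = a),
            ((ArithmeticFunction.liouville N : ℤ) : ℝ)| ≤
          (2 : ℝ) ^ i * (2 ^ τ * (A * Real.sqrt ε₁ + K' * Real.exp (-(c₂ * Real.sqrt (i * Real.log 2)))) +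
            2 / 2 ^ τ + 2 * 2 ^ k / 2 ^ h) := by
  sorry

/-- **Odd residue classes in aligned blocks (lead; CONDITIONAL on the KMT named fact).** For every `δ > 0` there is
`L` such that for all `n, k ≥ 1, h` with `k + L ≤ h ≤ n − L` and `L k² + L ≤ n`:
`Σ_{y<2^{n−h}} Σ_{a<2^k odd} |Σ_{N∈[2^h y, 2^h y+2^h), N≡a (2^k)} λ(N)| ≤ δ2ⁿ`.  Dyadic scales `[2^i, 2^{i+1})`,
`i ≥ L k²`: windows to the right of each block (`stub_kmt_window_average_AP`, `T = 2^{h−τ}`), Cauchy–Schwarz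
(`stub_kmt_cauchySchwarz`), the mean square from KMT (`stub_kmt_discretise`) and the main term from
`stub_kmt_mainTerm`; small scales trivially.
[cite: KlurmanMangerelTeravainen2023ShortAPs, Corollary 1.7 and Theorem 1.6] -/
theorem liouville_oddAP_blocks_le (hKMT : KMT2023_corollary17_liouville_twoPower) :
    ∀ δ : ℝ, 0 < δ → ∃ L : ℕ, ∀ n k h : ℕ, 1 ≤ k → k + L ≤ h → h + L ≤ n → L * k ^ 2 + L ≤ n →
      ∑ y ∈ range (2 ^ (n - h)), ∑ a ∈ (range (2 ^ k)).filter (fun a => Odd a),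
        |∑ N ∈ (Ico (2 ^ h * y) (2 ^ h * y + 2 ^ h)).filter (fun N => N % 2 ^ k = a),
          ((ArithmeticFunction.liouville N : ℤ) : ℝ)| ≤ δ * 2 ^ n := by
  sorry

/-! ### Lead: the window-free two-ends class and its consequences -/

/-- **The Klurman–Mangerel–Teräväinen class (lead; CONDITIONAL on the KMT named fact).** For every `ε > 0` there
are `c > 0` and `w₀` such that, eventually in `n`, for all `k ≤ c√n`, all `h` with `k + w₀ ≤ h ≤ n − w₀` and every
1-bounded `g`: `|Σ_{N<2ⁿ} λ(N) g(N mod 2^k, ⌊N/2^h⌋)| ≤ ε2ⁿ`.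
[cite: KlurmanMangerelTeravainen2023ShortAPs, Corollary 1.7 and Theorem 1.6] [cite: MatomakiRadziwillTao2015, Theorem 1.3] -/
theorem liouville_windowFree_weight_le (hKMT : KMT2023_corollary17_liouville_twoPower) :
    ∀ ε : ℝ, 0 < ε → ∃ c : ℝ, 0 < c ∧ ∃ w₀ : ℕ, ∀ᶠ n : ℕ in atTop, ∀ k h : ℕ,
      (k : ℝ) ≤ c * Real.sqrt n → k + w₀ ≤ h → h + w₀ ≤ n →
      ∀ g : ℕ → ℕ → ℝ, (∀ a b, |g a b| ≤ 1) →
        |∑ N ∈ range (2 ^ n), ((ArithmeticFunction.liouville N : ℤ) : ℝ) * g (N % 2 ^ k) (N / 2 ^ h)| ≤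
          ε * 2 ^ n := by
  sorry

/-- **The crux on the window-free class (lead; CONDITIONAL on the KMT named fact).** For every `ε > 0` there are
`c > 0`, `w₀` such that, eventually in `n`, every `P ∈ 𝔽₂[x_0,…,x_{n−1}]` (any degree) whose variables avoid a window
`[k, h)` of digit positions with `k ≤ c√n`, `k + w₀ ≤ h ≤ n − w₀` has `|Σ_{N<2ⁿ} λ(N)(−1)^{P(bits N)}| ≤ ε2ⁿ`.
[cite: KlurmanMangerelTeravainen2023ShortAPs, Corollary 1.7 and Theorem 1.6] -/
theorem digitPolyUniformity_windowFree (hKMT : KMT2023_corollary17_liouville_twoPower) :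
    ∀ ε : ℝ, 0 < ε → ∃ c : ℝ, 0 < c ∧ ∃ w₀ : ℕ, ∀ᶠ n : ℕ in atTop, ∀ P : MvPolynomial (Fin n) (ZMod 2),
      (∃ k h : ℕ, (k : ℝ) ≤ c * Real.sqrt n ∧ k + w₀ ≤ h ∧ h + w₀ ≤ n ∧
        ∀ i ∈ P.vars, (i : ℕ) < k ∨ h ≤ (i : ℕ)) →
      |∑ N ∈ range (2 ^ n), ((ArithmeticFunction.liouville N : ℤ) : ℝ) *
        (if MvPolynomial.eval (fun i : Fin n => if Nat.testBit N i then (1 : ZMod 2) else 0) P = 1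
          then (-1 : ℝ) else 1)| ≤ ε * (2 : ℝ) ^ n := by
  sorry

/-- **W from the NATURAL rigidity hypothesis (lead; CONDITIONAL on the KMT named fact).** Rigidity♮: polylog-degree
digital phases with small ×p-defects for all primes `p ≤ C` correlate with SOME window-free two-ends test
`g(N mod 2^k, ⌊N/2^h⌋)`, `k ≤ c√n`, `k + w₀ ≤ h ≤ n − w₀`, for the `c, w₀` prescribed by the λ-side (`∀ c > 0, ∀ w₀`).
Then, with `liouville_windowFree_weight_le`, the weak target W follows exactly as in `inapprox_range_of_rigidity`.
Rigidity♮ is a CONJECTURE of this line (λ-free), never asserted; every known near-solution family is an admissible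
test. [cite: KlurmanMangerelTeravainen2023ShortAPs, Corollary 1.7 and Theorem 1.6] -/
theorem inapprox_range_of_rigidity_natural (hKMT : KMT2023_corollary17_liouville_twoPower)
    (hR : ∃ C : ℕ, ∃ η ρ : ℝ, 0 < η ∧ 0 < ρ ∧ ∀ A : ℕ, ∀ c : ℝ, 0 < c → ∀ w₀ : ℕ, ∀ᶠ n : ℕ in atTop,
      ∀ P : MvPolynomial (Fin n) (ZMod 2), P.totalDegree ≤ Nat.log 2 n ^ A →
        (∀ p : ℕ, p.Prime → p ≤ C →
          ((((Ico 1 (2 ^ n / p)).filter fun m =>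
              (if MvPolynomial.eval (fun i : Fin n => if Nat.testBit (p * m) i then (1 : ZMod 2) else 0) P = 1
                then (-1 : ℝ) else 1) =
              (if MvPolynomial.eval (fun i : Fin n => if Nat.testBit m i then (1 : ZMod 2) else 0) P = 1
                then (-1 : ℝ) else 1)).card : ℕ) : ℝ) ≤ η * 2 ^ n) →
        ∃ k h : ℕ, (k : ℝ) ≤ c * Real.sqrt n ∧ k + w₀ ≤ h ∧ h + w₀ ≤ n ∧
          ∃ g : ℕ → ℕ → ℝ, (∀ a b, |g a b| ≤ 1) ∧
          ρ * 2 ^ n ≤ |∑ N ∈ range (2 ^ n),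
            (if MvPolynomial.eval (fun i : Fin n => if Nat.testBit N i then (1 : ZMod 2) else 0) P = 1
              then (-1 : ℝ) else 1) * g (N % 2 ^ k) (N / 2 ^ h)|) :
    ∃ c : ℝ, 0 < c ∧ ∀ A : ℕ, ∀ᶠ n : ℕ in atTop, ∀ P : MvPolynomial (Fin n) (ZMod 2),
        P.totalDegree ≤ Nat.log 2 n ^ A →
          ∑ N ∈ Finset.range (2 ^ n), ((ArithmeticFunction.liouville N : ℤ) : ℝ) *
              (if MvPolynomial.eval (fun i : Fin n => if Nat.testBit N i then (1 : ZMod 2) else 0) P = 1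
                then (-1 : ℝ) else 1) ≤ (1 - c) * (2 : ℝ) ^ n := by
  sorry

/-- **The `AC⁰[⊕]` rung from NATURAL rigidity (lead; CONDITIONAL on the KMT named fact)** — composition with the
landed weak glue (p135858). [cite: Razborov1987] [cite: Smolensky1987] -/
theorem liouvilleNotAC0Xor_of_rigidity_natural (hKMT : KMT2023_corollary17_liouville_twoPower)
    (hR : ∃ C : ℕ, ∃ η ρ : ℝ, 0 < η ∧ 0 < ρ ∧ ∀ A : ℕ, ∀ c : ℝ, 0 < c → ∀ w₀ : ℕ, ∀ᶠ n : ℕ in atTop,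
      ∀ P : MvPolynomial (Fin n) (ZMod 2), P.totalDegree ≤ Nat.log 2 n ^ A →
        (∀ p : ℕ, p.Prime → p ≤ C →
          ((((Ico 1 (2 ^ n / p)).filter fun m =>
              (if MvPolynomial.eval (fun i : Fin n => if Nat.testBit (p * m) i then (1 : ZMod 2) else 0) P = 1
                then (-1 : ℝ) else 1) =
              (if MvPolynomial.eval (fun i : Fin n => if Nat.testBit m i then (1 : ZMod 2) else 0) P = 1
                then (-1 : ℝ) else 1)).card : ℕ) : ℝ) ≤ η * 2 ^ n) →
        ∃ k h : ℕ, (k : ℝ) ≤ c * Real.sqrt n ∧ k + w₀ ≤ h ∧ h + w₀ ≤ n ∧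
          ∃ g : ℕ → ℕ → ℝ, (∀ a b, |g a b| ≤ 1) ∧
          ρ * 2 ^ n ≤ |∑ N ∈ range (2 ^ n),
            (if MvPolynomial.eval (fun i : Fin n => if Nat.testBit N i then (1 : ZMod 2) else 0) P = 1
              then (-1 : ℝ) else 1) * g (N % 2 ^ k) (N / 2 ^ h)|) :
    Computability.encodingNatBool.toLanguage {N : ℕ | ArithmeticFunction.liouville N = -1} ∉
      Literature.Computability.Complexity.AC0Mod 2 := by
  sorry


/-! ### Cycle 8 (seat c6): the KMT class with LINEAR bottom depth `k ≤ c·n` — registered stubs + lead theorems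

Real Dirichlet characters modulo `2^k` factor through `8` (the squares have index `4` in `(ℤ/2^k)ˣ`: every unit `≡ 1 (mod 8)` is
a square), so the main term of the Klurman–Mangerel–Teräväinen variance bound, `Σ_{X≤n≤2X} λ(n)χ₁(n)` with `χ₁` real, is bounded by
the tree's PROVED 2-power character bound at the FIXED modulus `8`, with NO condition linking `k` and `X` (`stub_kmt_mainTerm_free`).
Re-running cycle 7 with this input removes the constraint `k² log 2 ≤ c₂² i`; only KMT's `2^k ≤ X^{ε^{200}}` remains, and the class
holds with bottom depth `k ≤ c(ε)·n`: `kmt_oddAP_scale_le_free`, `liouville_oddAP_blocks_le_free` (`L k + L ≤ n`),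
`liouville_windowFree_weight_le_linear`, `digitPolyUniformity_windowFree_linear`, `inapprox_range_of_rigidity_linear`,
`liouvilleNotAC0Xor_of_rigidity_linear`. All CONDITIONAL on the KMT named fact only. -/

/-- **Stub KMT-M′ (main term, free of `k`).** Constants `c₂ > 0`, `K`, `X₀` with, for ALL `k`, all `X ≥ X₀` and every real
Dirichlet character `χ (mod 2^k)`: `|χ(a)| ≤ 1` and `|Σ_{X≤n≤2X} λ(n)χ(n)| ≤ K X e^{−c₂√log X}`.  A real character mod `2^k`
is induced from one of the four characters mod `8` (squares = units `≡ 1 (mod 8)`, `ZMod.orderOf_five`), and the tree's PROVED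
`green_liouville_character_twoPower_holds` applies at modulus `2^3` as soon as `8 ≤ e^{c₂√log X}`.
[cite: Green2012, Theorem 3 and §1 (remark on the Liouville function)] -/
theorem stub_kmt_mainTerm_free :
    ∃ c₂ : ℝ, 0 < c₂ ∧ ∃ K : ℝ, ∃ X₀ : ℕ, ∀ k X : ℕ, X₀ ≤ X →
      ∀ χ : DirichletCharacter ℝ (2 ^ k),
        (∀ a : ZMod (2 ^ k), |χ a| ≤ 1) ∧
        |∑ n ∈ Icc X (2 * X), (ArithmeticFunction.liouville n : ℝ) * χ (n : ZMod (2 ^ k))| ≤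
          K * X * Real.exp (-(c₂ * Real.sqrt (Real.log X))) := by
  sorry

/-- **Odd residue classes at one dyadic scale, no main-term constraint on `k` (CONDITIONAL on the KMT named fact).**
As `kmt_oddAP_scale_le` with `stub_kmt_mainTerm_free` in place of `stub_kmt_mainTerm`: the hypothesis `k² log 2 ≤ c₂² i`
is replaced by `X₀ ≤ 2^i`. [cite: KlurmanMangerelTeravainen2023ShortAPs, Corollary 1.7 and Theorem 1.6] -/
theorem kmt_oddAP_scale_le_free (hKMT : KMT2023_corollary17_liouville_twoPower) :
    ∃ A : ℝ, 0 ≤ A ∧ ∃ c₂ : ℝ, 0 < c₂ ∧ ∃ K' : ℝ, 0 ≤ K' ∧ ∃ X₀ : ℕ,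
      ∀ (ε₁ : ℝ) (τ i k h : ℕ), 0 < ε₁ → ε₁ ≤ 1 → 1 ≤ k → k + 4 ≤ h → τ ≤ h → h ≤ i → X₀ ≤ 2 ^ i →
        ε₁ ^ (-(200 : ℝ)) ≤ ((h - k : ℕ) : ℝ) * Real.log 2 →
        Real.log 541 ≤ ((h - k : ℕ) : ℝ) * ε₁ ^ 2 * Real.log 2 →
        (k : ℝ) ≤ ε₁ ^ (200 : ℕ) * i →
        ∑ y ∈ Ico (2 ^ (i - h)) (2 ^ (i + 1 - h)), ∑ a ∈ (range (2 ^ k)).filter (fun a => Odd a),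
          |∑ N ∈ (Ico (2 ^ h * y) (2 ^ h * y + 2 ^ h)).filter (fun N => N % 2 ^ k = a),
            ((ArithmeticFunction.liouville N : ℤ) : ℝ)| ≤
          (2 : ℝ) ^ i * (2 ^ τ * (A * Real.sqrt ε₁ + K' * Real.exp (-(c₂ * Real.sqrt (i * Real.log 2)))) +
            2 / 2 ^ τ + 2 * 2 ^ k / 2 ^ h) := by
  sorry

/-- **Odd residue classes in aligned blocks, linear range (CONDITIONAL on the KMT named fact).** For every `δ > 0` there
is `L` such that for all `n, k ≥ 1, h` with `k + L ≤ h ≤ n − L` and `L k + L ≤ n`: the odd-residue block sums total `≤ δ2ⁿ`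
(as `liouville_oddAP_blocks_le`, thresholds `i ≥ L₀ k`). [cite: KlurmanMangerelTeravainen2023ShortAPs, Corollary 1.7 and Theorem 1.6] -/
theorem liouville_oddAP_blocks_le_free (hKMT : KMT2023_corollary17_liouville_twoPower) :
    ∀ δ : ℝ, 0 < δ → ∃ L : ℕ, ∀ n k h : ℕ, 1 ≤ k → k + L ≤ h → h + L ≤ n → L * k + L ≤ n →
      ∑ y ∈ range (2 ^ (n - h)), ∑ a ∈ (range (2 ^ k)).filter (fun a => Odd a),
        |∑ N ∈ (Ico (2 ^ h * y) (2 ^ h * y + 2 ^ h)).filter (fun N => N % 2 ^ k = a),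
          ((ArithmeticFunction.liouville N : ℤ) : ℝ)| ≤ δ * 2 ^ n := by
  sorry

/-- **The KMT class with linear bottom depth (CONDITIONAL on the KMT named fact).** For every `ε > 0` there are `c > 0`,
`w₀` such that, eventually in `n`, for all `k ≤ c·n`, all `h` with `k + w₀ ≤ h ≤ n − w₀` and every 1-bounded `g`:
`|Σ_{N<2ⁿ} λ(N) g(N mod 2^k, ⌊N/2^h⌋)| ≤ ε2ⁿ`.
[cite: KlurmanMangerelTeravainen2023ShortAPs, Corollary 1.7 and Theorem 1.6] [cite: MatomakiRadziwillTao2015, Theorem 1.3] -/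
theorem liouville_windowFree_weight_le_linear (hKMT : KMT2023_corollary17_liouville_twoPower) :
    ∀ ε : ℝ, 0 < ε → ∃ c : ℝ, 0 < c ∧ ∃ w₀ : ℕ, ∀ᶠ n : ℕ in atTop, ∀ k h : ℕ,
      (k : ℝ) ≤ c * n → k + w₀ ≤ h → h + w₀ ≤ n →
      ∀ g : ℕ → ℕ → ℝ, (∀ a b, |g a b| ≤ 1) →
        |∑ N ∈ range (2 ^ n), ((ArithmeticFunction.liouville N : ℤ) : ℝ) * g (N % 2 ^ k) (N / 2 ^ h)| ≤
          ε * 2 ^ n := by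
  sorry

/-- **The crux on the window-free class, linear bottom depth (CONDITIONAL on the KMT named fact).**
[cite: KlurmanMangerelTeravainen2023ShortAPs, Corollary 1.7 and Theorem 1.6] -/
theorem digitPolyUniformity_windowFree_linear (hKMT : KMT2023_corollary17_liouville_twoPower) :
    ∀ ε : ℝ, 0 < ε → ∃ c : ℝ, 0 < c ∧ ∃ w₀ : ℕ, ∀ᶠ n : ℕ in atTop, ∀ P : MvPolynomial (Fin n) (ZMod 2),
      (∃ k h : ℕ, (k : ℝ) ≤ c * n ∧ k + w₀ ≤ h ∧ h + w₀ ≤ n ∧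
        ∀ i ∈ P.vars, (i : ℕ) < k ∨ h ≤ (i : ℕ)) →
      |∑ N ∈ range (2 ^ n), ((ArithmeticFunction.liouville N : ℤ) : ℝ) *
        (if MvPolynomial.eval (fun i : Fin n => if Nat.testBit N i then (1 : ZMod 2) else 0) P = 1
          then (-1 : ℝ) else 1)| ≤ ε * (2 : ℝ) ^ n := by
  sorry

/-- **W from rigidity with LINEAR-depth window-free tests (CONDITIONAL on the KMT named fact).** Rigidity♮-lin: the
natural rigidity hypothesis with tests `g(N mod 2^k, ⌊N/2^h⌋)`, `k ≤ c·n`, `k + w₀ ≤ h ≤ n − w₀` (`∀ c > 0, ∀ w₀`) — weaker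
than Rigidity♮ (more tests), still sufficient for W. A CONJECTURE of this line, never asserted.
[cite: KlurmanMangerelTeravainen2023ShortAPs, Corollary 1.7 and Theorem 1.6] -/
theorem inapprox_range_of_rigidity_linear (hKMT : KMT2023_corollary17_liouville_twoPower)
    (hR : ∃ C : ℕ, ∃ η ρ : ℝ, 0 < η ∧ 0 < ρ ∧ ∀ A : ℕ, ∀ c : ℝ, 0 < c → ∀ w₀ : ℕ, ∀ᶠ n : ℕ in atTop,
      ∀ P : MvPolynomial (Fin n) (ZMod 2), P.totalDegree ≤ Nat.log 2 n ^ A →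
        (∀ p : ℕ, p.Prime → p ≤ C →
          ((((Ico 1 (2 ^ n / p)).filter fun m =>
              (if MvPolynomial.eval (fun i : Fin n => if Nat.testBit (p * m) i then (1 : ZMod 2) else 0) P = 1
                then (-1 : ℝ) else 1) =
              (if MvPolynomial.eval (fun i : Fin n => if Nat.testBit m i then (1 : ZMod 2) else 0) P = 1
                then (-1 : ℝ) else 1)).card : ℕ) : ℝ) ≤ η * 2 ^ n) →
        ∃ k h : ℕ, (k : ℝ) ≤ c * n ∧ k + w₀ ≤ h ∧ h + w₀ ≤ n ∧
          ∃ g : ℕ → ℕ → ℝ, (∀ a b, |g a b| ≤ 1) ∧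
          ρ * 2 ^ n ≤ |∑ N ∈ range (2 ^ n),
            (if MvPolynomial.eval (fun i : Fin n => if Nat.testBit N i then (1 : ZMod 2) else 0) P = 1
              then (-1 : ℝ) else 1) * g (N % 2 ^ k) (N / 2 ^ h)|) :
    ∃ c : ℝ, 0 < c ∧ ∀ A : ℕ, ∀ᶠ n : ℕ in atTop, ∀ P : MvPolynomial (Fin n) (ZMod 2),
        P.totalDegree ≤ Nat.log 2 n ^ A →
          ∑ N ∈ Finset.range (2 ^ n), ((ArithmeticFunction.liouville N : ℤ) : ℝ) *
              (if MvPolynomial.eval (fun i : Fin n => if Nat.testBit N i then (1 : ZMod 2) else 0) P = 1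
                then (-1 : ℝ) else 1) ≤ (1 - c) * (2 : ℝ) ^ n := by
  sorry

/-- **The `AC⁰[⊕]` rung from linear-depth rigidity (CONDITIONAL on the KMT named fact).** [cite: Razborov1987] [cite: Smolensky1987] -/
theorem liouvilleNotAC0Xor_of_rigidity_linear (hKMT : KMT2023_corollary17_liouville_twoPower)
    (hR : ∃ C : ℕ, ∃ η ρ : ℝ, 0 < η ∧ 0 < ρ ∧ ∀ A : ℕ, ∀ c : ℝ, 0 < c → ∀ w₀ : ℕ, ∀ᶠ n : ℕ in atTop,
      ∀ P : MvPolynomial (Fin n) (ZMod 2), P.totalDegree ≤ Nat.log 2 n ^ A →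
        (∀ p : ℕ, p.Prime → p ≤ C →
          ((((Ico 1 (2 ^ n / p)).filter fun m =>
              (if MvPolynomial.eval (fun i : Fin n => if Nat.testBit (p * m) i then (1 : ZMod 2) else 0) P = 1
                then (-1 : ℝ) else 1) =
              (if MvPolynomial.eval (fun i : Fin n => if Nat.testBit m i then (1 : ZMod 2) else 0) P = 1
                then (-1 : ℝ) else 1)).card : ℕ) : ℝ) ≤ η * 2 ^ n) →
        ∃ k h : ℕ, (k : ℝ) ≤ c * n ∧ k + w₀ ≤ h ∧ h + w₀ ≤ n ∧
          ∃ g : ℕ → ℕ → ℝ, (∀ a b, |g a b| ≤ 1) ∧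
          ρ * 2 ^ n ≤ |∑ N ∈ range (2 ^ n),
            (if MvPolynomial.eval (fun i : Fin n => if Nat.testBit N i then (1 : ZMod 2) else 0) P = 1
              then (-1 : ℝ) else 1) * g (N % 2 ^ k) (N / 2 ^ h)|) :
    Computability.encodingNatBool.toLanguage {N : ℕ | ArithmeticFunction.liouville N = -1} ∉
      Literature.Computability.Complexity.AC0Mod 2 := by
  sorry

end KMT

end Summit.QuantumAdvantage.DigitPolyUniformity.SketchLAR

end
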